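import Summits.HodgeConjecture.CorCM.IrreducibleOddWeightsCommutantSeparation
import HarnessLib

/-!
# Row spaces over the commutant, II: the ROW-SPACE DICHOTOMY — two rows of an irreducible representation have
# DISJOINT or EQUAL coefficient spaces, equal iff the rows differ by an AUTOMORPHISM commuting with the group;
# in a rank-one model every defect `dim Hg(A₀)+dim Hg(A₁)−dim Hg(A₀×A₁)` is `0` or `dim_ℚ V`

COR-CM (cell `pub-hodgecm2`, binder seat `b16` gen 69, count-neutral claim ROW SPACES OVER THE COMMUTANT, file Q2 —
abstract representation level (§1) and gen 68's rank-one models (§2); theorems only, no definition, no named fact, no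
`sorry`).  NEW as stated, hence under `Summits/`.  HONEST FRAMING: linear algebra of matrix coefficients of an
irreducible `ℚ`-representation (Schur's lemma via Mathlib's `Representation.IsIrreducible.bijective_or_eq_zero`, and the
separation theorem of file Q1), with its consequence for the Kubota–Dodson rank of a pair of CM types in a rank-one model
(gen 68 P5); which pairs of CM fields realise a given model is a finite Galois computation left to the user; `HC_CM` is
neither used nor asserted.

SETTING.  `π : Representation ℚ G V`; the ROW SPACE of `φ ∈ V*` is `R(φ) = span{g ↦ φ(π g v) : v ∈ V} ≤ ℚ^G` (all
columns), `R(φ, S)` with columns `v ∈ S`.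

* §1 `R(φ)` is the range of the linear coefficient map `v ↦ (g ↦ φ(π g v))` (`span_range_coeff_eq_range`); columns from
  any SPANNING set give the same space (`span_image_coeff_eq_of_span_eq_top`); **`dim R(φ) = dim_ℚ V`** for `φ ≠ 0`, `π`
  irreducible (`finrank_span_range_coeff_eq`); `R(ψ ∘ d) ≤ R(ψ)` for an intertwining `d`, `=` if `d` is onto
  (`span_range_coeff_comp_le`, `…_eq_of_surjective`).  **THE ROW-SPACE DICHOTOMY** (`span_range_coeff_inf_eq_bot_or_eq`):
  for `π` irreducible and any `φ₀, φ₁`, **`R(φ₀) ∩ R(φ₁) = 0` or `R(φ₀) = R(φ₁)`**; the meet is non-zero IFF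
  `φ₀ = φ₁ ∘ d` for a BIJECTIVE intertwining `d` (`exists_bijective_of_span_range_coeff_inf_ne_bot`,
  `span_range_coeff_inf_ne_bot_iff`); so `dim(R(φ₀) ∩ R(φ₁)) ∈ {0, dim_ℚ V}` (`finrank_span_range_coeff_inf_eq_zero_or_eq`).
  Reading: the rows of an irreducible `V` with commutant `D = End_G(V)` (a division algebra) are classified by the
  `D×`-orbit of the functional; non-zero functionals in different orbits have complementary coefficient spaces.
* §2 RANK-ONE MODELS (gen 68 P5: shadow translates `w_κ(g·y) = φ_κ(π g (e_κ y))`, positions `e_κ` SPANNING `V`):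
  **`rank Φ₀ + rank Φ₁ = rank(Φ₀,Φ₁) + 1 + dim_ℚ V`** when `φ₀ = φ₁ ∘ d` with `d` a bijective intertwiner and `φ₁ ≠ 0`
  (`typeRank_add_typeRank_eq_add_finrank_of_bijective`) — the INTERACTING case, with BOTH shadow-coefficient spaces
  EQUAL (mutual absorption, `span_shadowCoeff_eq_of_bijective`); and in general THE DEFECT DICHOTOMY
  (`typeRank_add_typeRank_eq_or_eq_add_finrank`): `rank Φ₀ + rank Φ₁ − rank(Φ₀,Φ₁) − 1 ∈ {0, dim_ℚ V}`.  Census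
  dictionary (this generation, numerics): defect 2 = the D₄ and S₃ planes; defect 4 = the 4-dimensional module of the
  `GL₂(𝔽₃)` twins (commutant `ℚ(√−2)`) and of the dyadic (8,8) twins.

## References

* [Lang2002] S. Lang, *Algebra*, 3rd ed., XVII §3 (density, Burnside), XVII §1 Prop. 1.1 (Schur).
* [Serre1977] J.-P. Serre, *Linear Representations of Finite Groups*, GTM 42, §2.2.
* [CurtisReiner1962] C. W. Curtis, I. Reiner, *Representation Theory of Finite Groups and Associative Algebras*, §27.
* [Gordon1999HodgeAVSurvey] B. B. Gordon, *A survey of the Hodge conjecture for abelian varieties*, §3 Theorem, 7.5–7.7.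
-/

set_option autoImplicit false

noncomputable section

open scoped BigOperators Classical

universe u v v' v'' v''' w

namespace Summit.HodgeConjecture.CorCM.IrrOdd

open Literature.NumberTheory.ComplexMultiplication

variable {G : Type w} [Group G] {V : Type v} [AddCommGroup V] [Module ℚ V] {W : Type v'} [AddCommGroup W] [Module ℚ W]

/-! ### §1 Row spaces of an irreducible representation -/

/-- The coefficient map `v ↦ (g ↦ φ(π g v))` is the linear map `LinearMap.pi (g ↦ φ ∘ π g)`. [cite: Serre1977, §2.2] -/
theorem coeff_eq_pi_apply (π : Representation ℚ G V) (φ : Module.Dual ℚ V) :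
    (fun v : V => fun g : G => φ (π g v)) = ⇑(LinearMap.pi fun g : G => φ ∘ₗ π g) := by
  funext v g
  simp [LinearMap.pi_apply]

/-- `R(φ) =` the range of the coefficient map. [cite: Serre1977, §2.2] -/
theorem span_range_coeff_eq_range (π : Representation ℚ G V) (φ : Module.Dual ℚ V) :
    Submodule.span ℚ (Set.range fun v : V => fun g : G => φ (π g v)) =
      LinearMap.range (LinearMap.pi fun g : G => φ ∘ₗ π g) := by
  rw [coeff_eq_pi_apply, ← LinearMap.coe_range, Submodule.span_eq]

/-- Columns from a SPANNING set give the full row space: `span S = V ⟹ R(φ, S) = R(φ)`. [cite: Serre1977, §2.2] -/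
theorem span_image_coeff_eq_of_span_eq_top (π : Representation ℚ G V) (φ : Module.Dual ℚ V) {S : Set V}
    (hS : Submodule.span ℚ S = ⊤) :
    Submodule.span ℚ ((fun v : V => fun g : G => φ (π g v)) '' S) =
      Submodule.span ℚ (Set.range fun v : V => fun g : G => φ (π g v)) := by
  rw [span_range_coeff_eq_range, coeff_eq_pi_apply, Submodule.span_image, hS, Submodule.map_top]

/-- **`dim R(φ) = dim_ℚ V`** for a non-zero row of an irreducible representation: the coefficient map is injective (a
vector all of whose translates are killed by `φ ≠ 0` is zero, Q1). [cite: Serre1977, §2.2] [cite: Lang2002, XVII §3] -/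
theorem finrank_span_range_coeff_eq (π : Representation ℚ G V) [π.IsIrreducible] [FiniteDimensional ℚ V]
    {φ : Module.Dual ℚ V} (hφ : φ ≠ 0) :
    Module.finrank ℚ (Submodule.span ℚ (Set.range fun v : V => fun g : G => φ (π g v))) = Module.finrank ℚ V := by
  rw [span_range_coeff_eq_range]
  apply LinearMap.finrank_range_of_inj
  rw [← LinearMap.ker_eq_bot, Submodule.eq_bot_iff]
  intro v hv
  by_contra hv0
  apply hφ
  exact dual_eq_zero_of_forall_apply_eq_zero π hv0 φ fun g => by
    have h := congrFun (LinearMap.mem_ker.1 hv) g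
    simpa [LinearMap.pi_apply] using h

/-- A non-zero row has a non-zero row space. [cite: Serre1977, §2.2] -/
theorem span_range_coeff_ne_bot (π : Representation ℚ G V) {φ : Module.Dual ℚ V} (hφ : φ ≠ 0) :
    Submodule.span ℚ (Set.range fun v : V => fun g : G => φ (π g v)) ≠ ⊥ := by
  obtain ⟨v, hv⟩ : ∃ v : V, φ v ≠ 0 := by
    by_contra h
    push Not at h
    exact hφ (LinearMap.ext h)
  intro hbot
  have hmem : (fun g : G => φ (π g v)) ∈ Submodule.span ℚ (Set.range fun v : V => fun g : G => φ (π g v)) :=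
    Submodule.subset_span ⟨v, rfl⟩
  rw [hbot, Submodule.mem_bot] at hmem
  apply hv
  simpa using congrFun hmem 1

/-- **`R(ψ ∘ d, S) ≤ R(ψ, d(S))`** for an intertwining `d : V → W`: `(ψ ∘ d)(π g v) = ψ(σ g (d v))`.
[cite: Serre1977, §2.2] -/
theorem span_image_coeff_comp_le (π : Representation ℚ G V) (σ : Representation ℚ G W) (d : π.IntertwiningMap σ)
    (ψ : Module.Dual ℚ W) (S : Set V) :
    Submodule.span ℚ ((fun v : V => fun g : G => (ψ ∘ₗ d.toLinearMap) (π g v)) '' S) ≤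
      Submodule.span ℚ ((fun w : W => fun g : G => ψ (σ g w)) '' (d '' S)) := by
  apply Submodule.span_mono
  rintro _ ⟨v, hv, rfl⟩
  refine ⟨d v, ⟨v, hv, rfl⟩, funext fun g => ?_⟩
  change ψ (σ g (d v)) = ψ (d.toLinearMap (π g v))
  rw [Representation.IntertwiningMap.toLinearMap_apply, Representation.IntertwiningMap.isIntertwining π σ d g v]

/-- `R(ψ ∘ d) ≤ R(ψ)` (all columns). [cite: Serre1977, §2.2] -/
theorem span_range_coeff_comp_le (π : Representation ℚ G V) (σ : Representation ℚ G W) (d : π.IntertwiningMap σ)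
    (ψ : Module.Dual ℚ W) :
    Submodule.span ℚ (Set.range fun v : V => fun g : G => (ψ ∘ₗ d.toLinearMap) (π g v)) ≤
      Submodule.span ℚ (Set.range fun w : W => fun g : G => ψ (σ g w)) := by
  rw [← Set.image_univ, ← Set.image_univ]
  exact (span_image_coeff_comp_le π σ d ψ Set.univ).trans
    (Submodule.span_mono (Set.image_mono (Set.subset_univ _)))

/-- `R(ψ ∘ d) = R(ψ)` when the intertwining `d` is onto. [cite: Serre1977, §2.2] -/
theorem span_range_coeff_comp_eq_of_surjective (π : Representation ℚ G V) (σ : Representation ℚ G W)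
    (d : π.IntertwiningMap σ) (ψ : Module.Dual ℚ W) (hd : Function.Surjective d) :
    Submodule.span ℚ (Set.range fun v : V => fun g : G => (ψ ∘ₗ d.toLinearMap) (π g v)) =
      Submodule.span ℚ (Set.range fun w : W => fun g : G => ψ (σ g w)) := by
  refine le_antisymm (span_range_coeff_comp_le π σ d ψ) (Submodule.span_mono ?_)
  rintro _ ⟨w, rfl⟩
  obtain ⟨v, rfl⟩ := hd w
  refine ⟨v, funext fun g => ?_⟩
  change ψ (d.toLinearMap (π g v)) = ψ (σ g (d v))
  rw [Representation.IntertwiningMap.toLinearMap_apply, Representation.IntertwiningMap.isIntertwining π σ d g v]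

/-- **A NON-ZERO MEET FORCES A BIJECTIVE INTERTWINER**: if `R(φ₀) ∩ R(φ₁) ≠ 0` (π irreducible) then `φ₀ = φ₁ ∘ d`
for an intertwining BIJECTION `d` of `π` (Q1 separation + Schur). [cite: Lang2002, XVII §3 and XVII §1 Prop. 1.1] -/
theorem exists_bijective_of_span_range_coeff_inf_ne_bot (π : Representation ℚ G V) [π.IsIrreducible]
    {φ₀ φ₁ : Module.Dual ℚ V}
    (h : Submodule.span ℚ (Set.range fun v : V => fun g : G => φ₀ (π g v)) ⊓
      Submodule.span ℚ (Set.range fun v : V => fun g : G => φ₁ (π g v)) ≠ ⊥) :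
    ∃ d : π.IntertwiningMap π, Function.Bijective d ∧ φ₀ = φ₁ ∘ₗ d.toLinearMap := by
  obtain ⟨c, ⟨hc₀, hc₁⟩, hc⟩ := (Submodule.ne_bot_iff _).1 h
  rw [← Set.image_univ] at hc₀ hc₁
  obtain ⟨v, rfl⟩ := exists_eq_coeff_of_mem_span π φ₀ hc₀
  obtain ⟨v', hv'⟩ := exists_eq_coeff_of_mem_span π φ₁ hc₁
  rcases separate_of_isIrreducible π π φ₀ φ₁ v v' (fun g => congrFun hv' g) with hv | ⟨d, hd⟩
  · exact absurd (funext fun g => by simp [hv]) hc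
  · rcases Representation.IsIrreducible.bijective_or_eq_zero d with hbij | hzero
    · exact ⟨d, hbij, hd⟩
    · refine absurd (funext fun g => ?_) hc
      rw [hd, hzero]
      simp

/-- **THE ROW-SPACE DICHOTOMY**: for an irreducible `π` and any two rows, `R(φ₀) ∩ R(φ₁) = 0` or `R(φ₀) = R(φ₁)`.
[cite: Lang2002, XVII §3 and XVII §1 Prop. 1.1] [cite: Serre1977, §2.2] -/
theorem span_range_coeff_inf_eq_bot_or_eq (π : Representation ℚ G V) [π.IsIrreducible] (φ₀ φ₁ : Module.Dual ℚ V) :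
    Submodule.span ℚ (Set.range fun v : V => fun g : G => φ₀ (π g v)) ⊓
        Submodule.span ℚ (Set.range fun v : V => fun g : G => φ₁ (π g v)) = ⊥ ∨
      Submodule.span ℚ (Set.range fun v : V => fun g : G => φ₀ (π g v)) =
        Submodule.span ℚ (Set.range fun v : V => fun g : G => φ₁ (π g v)) := by
  by_cases h : Submodule.span ℚ (Set.range fun v : V => fun g : G => φ₀ (π g v)) ⊓
      Submodule.span ℚ (Set.range fun v : V => fun g : G => φ₁ (π g v)) = ⊥
  · exact Or.inl h
  · right
    obtain ⟨d, hbij, rfl⟩ := exists_bijective_of_span_range_coeff_inf_ne_bot π h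
    exact span_range_coeff_comp_eq_of_surjective π π d φ₁ hbij.2

/-- **EXACT CRITERION**: for `φ₀ ≠ 0`, `R(φ₀) ∩ R(φ₁) ≠ 0` IFF `φ₀ = φ₁ ∘ d` for a bijective intertwining `d` — the two
rows lie in the same orbit of the unit group of the commutant. [cite: Lang2002, XVII §3 and XVII §1 Prop. 1.1] -/
theorem span_range_coeff_inf_ne_bot_iff (π : Representation ℚ G V) [π.IsIrreducible] {φ₀ φ₁ : Module.Dual ℚ V}
    (hφ₀ : φ₀ ≠ 0) :
    Submodule.span ℚ (Set.range fun v : V => fun g : G => φ₀ (π g v)) ⊓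
        Submodule.span ℚ (Set.range fun v : V => fun g : G => φ₁ (π g v)) ≠ ⊥ ↔
      ∃ d : π.IntertwiningMap π, Function.Bijective d ∧ φ₀ = φ₁ ∘ₗ d.toLinearMap := by
  refine ⟨exists_bijective_of_span_range_coeff_inf_ne_bot π, ?_⟩
  rintro ⟨d, hbij, rfl⟩
  rw [span_range_coeff_comp_eq_of_surjective π π d φ₁ hbij.2, inf_idem]
  intro hbot
  apply span_range_coeff_ne_bot π hφ₀
  rw [span_range_coeff_comp_eq_of_surjective π π d φ₁ hbij.2, hbot]

/-- **`dim(R(φ₀) ∩ R(φ₁)) ∈ {0, dim_ℚ V}`** for an irreducible finite-dimensional `π`.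
[cite: Lang2002, XVII §3] [cite: Serre1977, §2.2] -/
theorem finrank_span_range_coeff_inf_eq_zero_or_eq (π : Representation ℚ G V) [π.IsIrreducible]
    [FiniteDimensional ℚ V] (φ₀ φ₁ : Module.Dual ℚ V) :
    Module.finrank ℚ (Submodule.span ℚ (Set.range fun v : V => fun g : G => φ₀ (π g v)) ⊓
        Submodule.span ℚ (Set.range fun v : V => fun g : G => φ₁ (π g v)) : Submodule ℚ (G → ℚ)) = 0 ∨
      Module.finrank ℚ (Submodule.span ℚ (Set.range fun v : V => fun g : G => φ₀ (π g v)) ⊓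
        Submodule.span ℚ (Set.range fun v : V => fun g : G => φ₁ (π g v)) : Submodule ℚ (G → ℚ)) =
        Module.finrank ℚ V := by
  rcases span_range_coeff_inf_eq_bot_or_eq π φ₀ φ₁ with h | h
  · left
    rw [h, finrank_bot]
  · by_cases hφ₀ : φ₀ = 0
    · left
      have hbot : Submodule.span ℚ (Set.range fun v : V => fun g : G => φ₀ (π g v)) = ⊥ := by
        rw [Submodule.span_eq_bot]
        rintro _ ⟨v, rfl⟩
        funext g
        simp [hφ₀]
      rw [hbot, bot_inf_eq, finrank_bot]
    · right
      rw [← h, inf_idem, finrank_span_range_coeff_eq π hφ₀]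

/-- **`dim(R(φ₀) ∩ R(φ₁)) = dim_ℚ V` IFF the rows differ by a unit of the commutant** (`φ₀ ≠ 0`, `π` irreducible,
finite-dimensional). [cite: Lang2002, XVII §3 and XVII §1 Prop. 1.1] -/
theorem finrank_span_range_coeff_inf_eq_iff (π : Representation ℚ G V) [π.IsIrreducible] [FiniteDimensional ℚ V]
    {φ₀ φ₁ : Module.Dual ℚ V} (hφ₀ : φ₀ ≠ 0) :
    Module.finrank ℚ (Submodule.span ℚ (Set.range fun v : V => fun g : G => φ₀ (π g v)) ⊓
        Submodule.span ℚ (Set.range fun v : V => fun g : G => φ₁ (π g v)) : Submodule ℚ (G → ℚ)) =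
        Module.finrank ℚ V ↔
      ∃ d : π.IntertwiningMap π, Function.Bijective d ∧ φ₀ = φ₁ ∘ₗ d.toLinearMap := by
  rw [← span_range_coeff_inf_ne_bot_iff π hφ₀]
  have hpos : 0 < Module.finrank ℚ V := by
    rw [Module.finrank_pos_iff]
    rw [← Submodule.nontrivial_iff ℚ]  -- bot ≠ top as submodules
    refine ⟨⟨⊥, ⊤, fun hbt => ?_⟩⟩
    have hst : (⊥ : Subrepresentation π) = ⊤ := Subrepresentation.toSubmodule_injective hbt
    exact IsSimpleOrder.bot_ne_top hst  -- check name
  haveI : FiniteDimensional ℚ (Submodule.span ℚ (Set.range fun v : V => fun g : G => φ₀ (π g v))) := by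
    rw [span_range_coeff_eq_range]; infer_instance
  constructor
  · intro h hbot
    rw [hbot, finrank_bot] at h
    omega
  · intro h
    rcases finrank_span_range_coeff_inf_eq_zero_or_eq π φ₀ φ₁ with h0 | h1
    · exact absurd (Submodule.finrank_eq_zero.1 h0) h
    · exact h1

/-! ### §2 Rank-one models: the defect is `0` or `dim_ℚ V` -/

variable {I : Type u} {E : I → Type v'''} [∀ i, MulAction G (E i)] [∀ i, Fintype (E i)] [Fintype I]
  [∀ i, Nonempty (E i)] {Y₀ : Type v'} [DecidableEq Y₀] [MulAction G Y₀] {Y₁ : Type v''} [DecidableEq Y₁]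
  [MulAction G Y₁]

omit [Fintype I] [∀ i, Nonempty (E i)] in
/-- In a rank-one model the shadow-coefficient space of slot `κ` IS the row space `R(φ_κ)` when the positions `e_κ(y)`
span `V`. [cite: Serre1977, §2.2] [cite: Gordon1999HodgeAVSurvey, §3 Theorem (proof)] -/
theorem span_shadowCoeff_eq_span_range_coeff {Φ : ∀ i, Set (E i)} {i₀ : I} (r₀ : E i₀ → Y₀)
    (π : Representation ℚ G V) (φ₀ : Module.Dual ℚ V) (e₀ : Y₀ → V) (he₀ : Submodule.span ℚ (Set.range e₀) = ⊤)
    (hw₀ : ∀ (y : Y₀) (g : G), ∑ x ∈ Finset.univ.filter (fun x => r₀ x = g • y), antiVec (Φ i₀) (1 : G) x =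
      φ₀ (π g (e₀ y))) :
    Submodule.span ℚ (Set.range fun y : Y₀ => fun g : G =>
        ∑ x ∈ Finset.univ.filter (fun x => r₀ x = g • y), antiVec (Φ i₀) (1 : G) x) =
      Submodule.span ℚ (Set.range fun v : V => fun g : G => φ₀ (π g v)) := by
  have hS₀ : (Set.range fun y : Y₀ => fun g : G =>
      ∑ x ∈ Finset.univ.filter (fun x => r₀ x = g • y), antiVec (Φ i₀) (1 : G) x) =
        (fun v : V => fun g : G => φ₀ (π g v)) '' Set.range e₀ := by
    ext c
    simp only [Set.mem_range, Set.mem_image, exists_exists_eq_and]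
    constructor
    · rintro ⟨y, rfl⟩
      exact ⟨y, funext fun g => (hw₀ y g).symm⟩
    · rintro ⟨y, rfl⟩
      exact ⟨y, funext fun g => hw₀ y g⟩
  rw [hS₀, span_image_coeff_eq_of_span_eq_top π φ₀ he₀]

omit [Fintype I] [∀ i, Nonempty (E i)] in
/-- **MUTUAL ABSORPTION IN THE INTERACTING CASE**: if `φ₀ = φ₁ ∘ d` with `d` a bijective intertwiner, the two
shadow-coefficient spaces of the model COINCIDE. [cite: Serre1977, §2.2] [cite: Lang2002, XVII §1 Prop. 1.1] -/
theorem span_shadowCoeff_eq_of_bijective {Φ : ∀ i, Set (E i)} {i₀ i₁ : I} (r₀ : E i₀ → Y₀) (r₁ : E i₁ → Y₁)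
    (π : Representation ℚ G V) {φ₀ φ₁ : Module.Dual ℚ V} (d : π.IntertwiningMap π) (hd : Function.Bijective d)
    (hφ : φ₀ = φ₁ ∘ₗ d.toLinearMap) (e₀ : Y₀ → V) (e₁ : Y₁ → V) (he₀ : Submodule.span ℚ (Set.range e₀) = ⊤)
    (he₁ : Submodule.span ℚ (Set.range e₁) = ⊤)
    (hw₀ : ∀ (y : Y₀) (g : G), ∑ x ∈ Finset.univ.filter (fun x => r₀ x = g • y), antiVec (Φ i₀) (1 : G) x =
      φ₀ (π g (e₀ y)))
    (hw₁ : ∀ (y : Y₁) (g : G), ∑ x ∈ Finset.univ.filter (fun x => r₁ x = g • y), antiVec (Φ i₁) (1 : G) x =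
      φ₁ (π g (e₁ y))) :
    Submodule.span ℚ (Set.range fun y : Y₀ => fun g : G =>
        ∑ x ∈ Finset.univ.filter (fun x => r₀ x = g • y), antiVec (Φ i₀) (1 : G) x) =
      Submodule.span ℚ (Set.range fun y : Y₁ => fun g : G =>
        ∑ x ∈ Finset.univ.filter (fun x => r₁ x = g • y), antiVec (Φ i₁) (1 : G) x) := by
  rw [span_shadowCoeff_eq_span_range_coeff r₀ π φ₀ e₀ he₀ hw₀, span_shadowCoeff_eq_span_range_coeff r₁ π φ₁ e₁ he₁ hw₁,
    hφ, span_range_coeff_comp_eq_of_surjective π π d φ₁ hd.2]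

/-- **THE INTERACTING CASE OF A RANK-ONE MODEL**: `π` irreducible and finite-dimensional, positions spanning `V`,
moments related by a unit of the commutant (`φ₀ = φ₁ ∘ d`, `d` bijective intertwining, `φ₁ ≠ 0`) ⟹
**`rank Φ₀ + rank Φ₁ = rank(Φ₀,Φ₁) + 1 + dim_ℚ V`**: the defect is the FULL dimension of the common constituent.
[cite: Gordon1999HodgeAVSurvey, §3 Theorem, 7.5–7.7] [cite: Lang2002, XVII §3] -/
theorem typeRank_add_typeRank_eq_add_finrank_of_bijective [FiniteDimensional ℚ V] {ρ : G} {Φ : ∀ i, Set (E i)}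
    (h : ∀ i, IsCMTypeWith ρ (Φ i)) {i₀ i₁ : I} (hI : ∀ j, j = i₀ ∨ j = i₁) (h01 : i₀ ≠ i₁)
    (r₀ : E i₀ → Y₀) (r₁ : E i₁ → Y₁) (hr₀ : ∀ (g : G) (x : E i₀), r₀ (g • x) = g • r₀ x)
    (hr₁ : ∀ (g : G) (x : E i₁), r₁ (g • x) = g • r₁ x)
    (hfine₀ : ∀ x x' : E i₀, r₀ x = r₀ x' → ∃ n : G, (∀ y : E i₁, n • y = y) ∧ n • x = x')
    (hfine₁ : ∀ x x' : E i₁, r₁ x = r₁ x' → ∃ n : G, (∀ y : E i₀, n • y = y) ∧ n • x = x')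
    (π : Representation ℚ G V) [π.IsIrreducible] {φ₀ φ₁ : Module.Dual ℚ V} (hφ₁ : φ₁ ≠ 0)
    (d : π.IntertwiningMap π) (hd : Function.Bijective d) (hφ : φ₀ = φ₁ ∘ₗ d.toLinearMap)
    (e₀ : Y₀ → V) (e₁ : Y₁ → V) (he₀ : Submodule.span ℚ (Set.range e₀) = ⊤)
    (he₁ : Submodule.span ℚ (Set.range e₁) = ⊤)
    (hw₀ : ∀ (y : Y₀) (g : G), ∑ x ∈ Finset.univ.filter (fun x => r₀ x = g • y), antiVec (Φ i₀) (1 : G) x =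
      φ₀ (π g (e₀ y)))
    (hw₁ : ∀ (y : Y₁) (g : G), ∑ x ∈ Finset.univ.filter (fun x => r₁ x = g • y), antiVec (Φ i₁) (1 : G) x =
      φ₁ (π g (e₁ y))) :
    typeRank G (Φ i₀) + typeRank G (Φ i₁) = typeRank G (sigmaType Φ) + 1 + Module.finrank ℚ V := by
  have hpair := typeRank_add_typeRank_eq_add_finrank_shadowCoeff_inf_shadowCoeff_of_fine h hI h01 r₀ r₁ hr₀ hr₁
    hfine₀ hfine₁
  rw [span_shadowCoeff_eq_span_range_coeff r₀ π φ₀ e₀ he₀ hw₀, span_shadowCoeff_eq_span_range_coeff r₁ π φ₁ e₁ he₁ hw₁,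
    hφ, span_range_coeff_comp_eq_of_surjective π π d φ₁ hd.2, inf_idem, finrank_span_range_coeff_eq π hφ₁] at hpair
  exact hpair

/-- **THE DEFECT DICHOTOMY OF A RANK-ONE MODEL**: `π` irreducible and finite-dimensional, positions spanning `V`, ANY
two moment functionals ⟹ `rank Φ₀ + rank Φ₁ = rank(Φ₀,Φ₁) + 1` (additive) OR `= rank(Φ₀,Φ₁) + 1 + dim_ℚ V` — the
defect `dim Hg(A₀)+dim Hg(A₁)−dim Hg(A₀×A₁)` of a pair carried by ONE irreducible constituent is `0` or `dim_ℚ V`,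
never in between. [cite: Gordon1999HodgeAVSurvey, §3 Theorem, 7.5–7.7] [cite: Lang2002, XVII §3] -/
theorem typeRank_add_typeRank_eq_or_eq_add_finrank [FiniteDimensional ℚ V] {ρ : G} {Φ : ∀ i, Set (E i)}
    (h : ∀ i, IsCMTypeWith ρ (Φ i)) {i₀ i₁ : I} (hI : ∀ j, j = i₀ ∨ j = i₁) (h01 : i₀ ≠ i₁)
    (r₀ : E i₀ → Y₀) (r₁ : E i₁ → Y₁) (hr₀ : ∀ (g : G) (x : E i₀), r₀ (g • x) = g • r₀ x)
    (hr₁ : ∀ (g : G) (x : E i₁), r₁ (g • x) = g • r₁ x)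
    (hfine₀ : ∀ x x' : E i₀, r₀ x = r₀ x' → ∃ n : G, (∀ y : E i₁, n • y = y) ∧ n • x = x')
    (hfine₁ : ∀ x x' : E i₁, r₁ x = r₁ x' → ∃ n : G, (∀ y : E i₀, n • y = y) ∧ n • x = x')
    (π : Representation ℚ G V) [π.IsIrreducible] (φ₀ φ₁ : Module.Dual ℚ V)
    (e₀ : Y₀ → V) (e₁ : Y₁ → V) (he₀ : Submodule.span ℚ (Set.range e₀) = ⊤)
    (he₁ : Submodule.span ℚ (Set.range e₁) = ⊤)
    (hw₀ : ∀ (y : Y₀) (g : G), ∑ x ∈ Finset.univ.filter (fun x => r₀ x = g • y), antiVec (Φ i₀) (1 : G) x =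
      φ₀ (π g (e₀ y)))
    (hw₁ : ∀ (y : Y₁) (g : G), ∑ x ∈ Finset.univ.filter (fun x => r₁ x = g • y), antiVec (Φ i₁) (1 : G) x =
      φ₁ (π g (e₁ y))) :
    typeRank G (Φ i₀) + typeRank G (Φ i₁) = typeRank G (sigmaType Φ) + 1 ∨
      typeRank G (Φ i₀) + typeRank G (Φ i₁) = typeRank G (sigmaType Φ) + 1 + Module.finrank ℚ V := by
  have hpair := typeRank_add_typeRank_eq_add_finrank_shadowCoeff_inf_shadowCoeff_of_fine h hI h01 r₀ r₁ hr₀ hr₁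
    hfine₀ hfine₁
  rw [span_shadowCoeff_eq_span_range_coeff r₀ π φ₀ e₀ he₀ hw₀,
    span_shadowCoeff_eq_span_range_coeff r₁ π φ₁ e₁ he₁ hw₁] at hpair
  rcases finrank_span_range_coeff_inf_eq_zero_or_eq π φ₀ φ₁ with h0 | hV
  · left
    rw [h0, add_zero] at hpair
    exact hpair
  · right
    rw [hV] at hpair
    exact hpair

end Summit.HodgeConjecture.CorCM.IrrOdd

end
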